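import Summits.BirchSwinnertonDyer.BirchSwinnertonDyer.Theorems.ClassRecordThreeHalvesAtThreeBDPValue
import Summits.BirchSwinnertonDyer.BirchSwinnertonDyer.Theses.KolyvaginRoadThree
import HarnessLib

/-!
# Route `KolyvaginRoadThree`, crux `HalvesTamAtThree` (item stmt-BirchSwinnertonDyer-19155) — implied by
# `ClassRecordThree.HalvesAtThree`; its H2 half from THEOREM C typed; the item reduced to its one open half H3

Cell `bsd-stepL` (run/shared/lean/pub/bsd-stepL/), seat `bsd-stepL-thmc-p1` (prover g0, D-0074 hands, 2026-08-26),
`--supports stmt-BirchSwinnertonDyer-19155` (route `route-BirchSwinnertonDyer-KolyvaginRoadThree`, crux 4 =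
`HalvesTamAtThree`: ClassRecordThree's `HalvesAtThree` (item 19107) with the Tamagawa binder `3 ∣ ∏ c_ℓ` added in
the (ram) clause — for `E ∈ X11b` at 3, on (3 split ∧ (ram) ∧ 3 ∣ ∏c) and on (¬(ram) ∧ ρ̄ onto), the BDP value
formula `Three.BDPValueAt₃ W` (H2) and the main-conjecture divisibility `Three.IMCDivAt₃ W` (H3)). Companion of
`Theorems/ClassRecordThreeHalvesAtThreeBDPValue.lean` (item 19107), whose vocabulary it reuses.

## What this file records in the kernel

1. `halvesTamAtThree_of_halvesAtThree` — the sketch lemma `halvesTamAtThree_of` of the route design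
   (plan/K2KOLY/v2): `ClassRecordThree.HalvesAtThree → KolyvaginRoadThree.HalvesTamAtThree` (drop the binder).
2. `kolyvaginRoadThree_halvesTamAtThree_iff` — locus form: the crux ⟺ for every `E ∈ X11b@3` with `ρ̄_{E,3}`
   onto and ((ram) ⟹ 3 split ∧ 3 ∣ ∏c), both halves hold (the halves are vacuous off the surjective locus —
   `bdpValueAt₃_of_not_surj` ∕ `imcDivAt₃_of_not_surj` of the companion file).
3. `kolyvaginRoadThree_halvesTamAtThree_bdpValue_of_classicalFrameValue` — THEOREM C typed (PROOF-BDP §20; the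
   binder `h12` of `Three.bdpValueAt₃_of_frameValue`, ∀ W, INLINE hypothesis) ⟹ the H2 stub of the item's BC3
   skeleton (`stub_bdpValueTamAtThree`, both loci) — CONDITIONAL.
4. `kolyvaginRoadThree_halvesTamAtThree_of_classicalFrameValue_of_imcDiv` ∕ `…_of_imcDivStub` — modulo THEOREM C
   typed the item IS its H3 half `Three.IMCDivAt₃` on the locus {surj} ∩ ((ram) ⟹ split ∧ 3 ∣ ∏c) (OPEN at
   `p = 3`); and `imcDivAt₃_of_kolyvaginRoadThree_halvesTamAtThree` extracts H3 back.

HONEST FRAMING: implications only; THEOREM C is a refereed MEMO theorem of the cell (VERDICT-THMC-g7; C♯ g19 ∕ g21),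
not a kernel theorem and not a Literature fact; H3 at `p = 3` is open. Nothing is discharged; no node, label or
census count moves (T7); O2 stays OPEN.

References: [Castella2018] Camb. J. Math. 6 (2018) = arXiv:1704.06608, Thm. 3.2–3.3 (p. 9), §5 (p. 12);
[CastellaHsieh2018] Math. Ann. 370, Prop. 3.6; [KrizLi2019] Forum Math. Sigma 7 e15 §2; cell memo PROOF-BDP §20
(THEOREM C) ∕ §21 (C♯); plan/K2KOLY/v2/Route-KolyvaginRoadThree.v2.md (crux 4).
-/

noncomputable section

open scoped Classical Topology

open Filter WeierstrassCurve NumberField IsDedekindDomain Field PowerSeries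
  Literature.NumberTheory.EllipticCurves Literature.NumberTheory.EllipticCurves.ModularForms
  Literature.NumberTheory.EllipticCurves.Rank1Residual
  Literature.NumberTheory.GaloisRepresentations Literature.NumberTheory.GaloisCohomology
  Summit.BirchSwinnertonDyer.Rank1Residual Summit.BirchSwinnertonDyer.Rank1Residual.X11b
  Summit.BirchSwinnertonDyer.Rank1Residual.X11b.AcSelmer
  Summit.BirchSwinnertonDyer.Rank1Residual.X11b.CongruenceLimit
  Summit.BirchSwinnertonDyer.Rank1Residual.X11b.Halves
  Summit.BirchSwinnertonDyer.Rank1Residual.X11b.Three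
  Summit.BirchSwinnertonDyer.BirchSwinnertonDyer.Theses.ClassRecordThree
  Summit.BirchSwinnertonDyer.BirchSwinnertonDyer.Theses.KolyvaginRoadThree

namespace Summit.BirchSwinnertonDyer.BirchSwinnertonDyer.Theorems

/-! ## §1 `HalvesAtThree ⟹ HalvesTamAtThree` and the locus form -/

/-- **ClassRecordThree's `HalvesAtThree` (item 19107) implies KolyvaginRoadThree's `HalvesTamAtThree` (item
19155)**: the latter is the former with the extra binder `3 ∣ ∏ c_ℓ` in the (ram) clause, which is simply
dropped (the route design's sketch lemma `halvesTamAtThree_of`). [folklore] -/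
theorem halvesTamAtThree_of_halvesAtThree (h : HalvesAtThree) : HalvesTamAtThree := by
  unfold HalvesTamAtThree
  intro W _ _ hX
  obtain ⟨h₁, h₂⟩ := h W hX
  exact ⟨fun hr hs _ ↦ h₁ hr hs, h₂⟩

/-- **`HalvesTamAtThree` in locus form.** The crux is equivalent to: for every `E ∈ X11b` at 3 with `ρ̄_{E,3}`
surjective such that a (ram) witness forces (3 split ∧ `3 ∣ ∏ c_ℓ`), both halves `BDPValueAt₃ W` and
`IMCDivAt₃ W` hold — both halves being vacuous off `Surj` (companion file §1). The complement inside X11b@3 ∩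
{surj} is ((ram) ∧ non-split at 3) ∪ ((ram) ∧ 3 ∤ ∏c) = road (a)'s Tamagawa cells ∪ atom A1 (the Kolyvagin road's
`ZhangSharpFrameAtThree`). [folklore] -/
theorem kolyvaginRoadThree_halvesTamAtThree_iff :
    HalvesTamAtThree ↔
      ∀ (W : WeierstrassCurve ℚ) [W.IsElliptic] [W.IsGloballyMinimal], ClassX11b W 3 → Surj W 3 →
        (Ram W 3 → W.HasSplitMultiplicativeReductionAtPrime 3 ∧ 3 ∣ W.tamagawaProduct) →
          BDPValueAt₃ W ∧ IMCDivAt₃ W := by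
  unfold HalvesTamAtThree
  constructor
  · intro h W _ _ hX hsurj hloc
    obtain ⟨h₁, h₂⟩ := h W hX
    by_cases hr : Ram W 3
    · exact h₁ hr (hloc hr).1 (hloc hr).2
    · exact h₂ hr hsurj
  · intro h W _ _ hX
    refine ⟨fun hr hs ht ↦ ?_, fun hnr hsurj ↦ h W hX hsurj (fun hr ↦ absurd hr hnr)⟩
    by_cases hsurj : Surj W 3
    · exact h W hX hsurj (fun _ ↦ ⟨hs, ht⟩)
    · exact ⟨bdpValueAt₃_of_not_surj W hsurj, imcDivAt₃_of_not_surj W hsurj⟩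

/-- The H3 content of `HalvesTamAtThree`, extracted: on the locus {surj} ∩ ((ram) ⟹ 3 split ∧ 3 ∣ ∏c) of X11b@3
the crux gives `Three.IMCDivAt₃ W`. [folklore] -/
theorem imcDivAt₃_of_kolyvaginRoadThree_halvesTamAtThree (h : HalvesTamAtThree) (W : WeierstrassCurve ℚ)
    [W.IsElliptic] [W.IsGloballyMinimal] (hX : ClassX11b W 3) (hsurj : Surj W 3)
    (hloc : Ram W 3 → W.HasSplitMultiplicativeReductionAtPrime 3 ∧ 3 ∣ W.tamagawaProduct) : IMCDivAt₃ W :=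
  (kolyvaginRoadThree_halvesTamAtThree_iff.mp h W hX hsurj hloc).2

/-! ## §2 THEOREM C typed (class-wide) ⟹ the H2 stub on both loci; the item reduced to H3 -/

section TheoremC

/- THEOREM C of the cell at `p = 3`, TYPED = the binder `h12` of `Three.bdpValueAt₃_of_frameValue` verbatim, ∀ W
(same text as in the companion file; INLINE hypothesis, no definition). Memo-proved and refereed; NOT a kernel
theorem: everything in this section is conditional on it. -/
variable
  (hC : ∀ (W : WeierstrassCurve ℚ) [W.IsElliptic] [W.IsGloballyMinimal],
    ∀ (N : ℕ) [NeZero N] (K : Type) [Field K] [NumberField K] (Dt : ModularParametrizationData W N)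
    (H : HeegnerDatum N (NumberField.discr K)) (ι : K →+* ℂ) (P : (W.baseChange K).toAffine.Point),
    ClassX11b W 3 → Surj W 3 → W.conductorNorm ℤ = N → IsImaginaryQuadratic K →
    Odd (NumberField.discr K) → SatisfiesHeegnerHypothesis N K →
    (W.quadraticTwist (NumberField.discr K : ℚ)).entireLFunction 1 ≠ 0 →
    WeierstrassCurve.Affine.Point.map ι.toRatAlgHom P = heegnerPointComplex Dt H →
    ¬ (3 : ℤ) ∣ Dt.c → ¬ IsOfFinAddOrder P →
    ∀ (κ : ZpExtension K 3), κ.IsAnticyclotomic →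
      ∀ (γ : Field.absoluteGaloisGroup K) [Fact (κ.IsTopGenerator γ)]
        (𝔭 : HeightOneSpectrum (𝓞 K)) (h𝔭 : ((3 : ℕ) : 𝓞 K) ∈ 𝔭.asIdeal)
        (he : 𝔭.asIdeal.ramificationIdx (𝓞 ℚ) = 1) (hf : 𝔭.asIdeal.inertiaDeg (𝓞 ℚ) = 1),
        ∀ (f : CuspForm (CongruenceSubgroup.Gamma0 N) 2), IsNewformOf W f →
          ∀ (ι' : PadicAlgCl 3 ≃+* ℂ), InducesPrime ι' 𝔭 →
            ∃ (ΩK : ℂ) (Ωp : (unrIntegers 3)ˣ) (L : UnrSeries 3),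
              ΩK ≠ 0 ∧ IsBDPLFunction ι' 𝔭 κ γ f ΩK ((Ωp : unrIntegers 3) : ℂ_[3]) L ∧
              ∃ u : (unrIntegers 3)ˣ, L.HasValueAt 0 (((u : unrIntegers 3) : ℂ_[3]) *
                (algebraMap ℚ_[3] ℂ_[3] (((1 : ℚ_[3]) - ((W.LFunction 3 : ℤ) : ℚ_[3]) * (3 : ℚ_[3])⁻¹) *
                  logOmega W 3 (embAt K 3 𝔭 h𝔭 he hf) P)) ^ 2))

include hC in
/-- **THEOREM C typed ⟹ the H2 stub of crux `HalvesTamAtThree` on BOTH loci** — verbatim the stub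
`stub_bdpValueTamAtThree` of the item's BC3 skeleton: for `E ∈ X11b` at 3, (ram) → 3 split → 3 ∣ ∏c →
`BDPValueAt₃ W`, and ¬(ram) → surj → `BDPValueAt₃ W`. The loci binders are idle (THEOREM C gives H2 on every
X11b@3 curve with surjective image; H2 is vacuous otherwise). CONDITIONAL on THEOREM C typed (`hC`).
[cite: Castella2018, Thm. 3.2 (arXiv:1704.06608 p. 9) (shape only; antecedent = PROOF-BDP §20 THEOREM C)] -/
theorem kolyvaginRoadThree_halvesTamAtThree_bdpValue_of_classicalFrameValue :
    ∀ (W : WeierstrassCurve ℚ) [W.IsElliptic] [W.IsGloballyMinimal],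
      Summit.BirchSwinnertonDyer.Rank1Residual.ClassX11b W 3 →
        (Literature.NumberTheory.EllipticCurves.Rank1Residual.Ram W 3 →
            W.HasSplitMultiplicativeReductionAtPrime 3 → 3 ∣ W.tamagawaProduct →
              Summit.BirchSwinnertonDyer.Rank1Residual.X11b.Three.BDPValueAt₃ W) ∧
          (¬ Literature.NumberTheory.EllipticCurves.Rank1Residual.Ram W 3 →
            Literature.NumberTheory.EllipticCurves.Rank1Residual.Surj W 3 →
              Summit.BirchSwinnertonDyer.Rank1Residual.X11b.Three.BDPValueAt₃ W) :=
  fun W _ _ _ ↦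
    ⟨fun _ _ _ ↦ bdpValueAt₃_of_classicalFrameValue hC W, fun _ _ ↦ bdpValueAt₃_of_classicalFrameValue hC W⟩

include hC in
/-- **The item reduced to its one open half.** Modulo THEOREM C typed, `HalvesTamAtThree` follows from H3 =
`Three.IMCDivAt₃ W` on the locus {`E ∈ X11b@3`, `ρ̄_{E,3}` onto, (ram) ⟹ (3 split ∧ 3 ∣ ∏c)}. H3 is OPEN at
`p = 3`; it is the hypothesis `h3`. Nothing is discharged.
[cite: Castella2018, Thm. 3.3 (arXiv:1704.06608 p. 9) (shape of H3 only; open at p = 3)] -/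
theorem kolyvaginRoadThree_halvesTamAtThree_of_classicalFrameValue_of_imcDiv
    (h3 : ∀ (W : WeierstrassCurve ℚ) [W.IsElliptic] [W.IsGloballyMinimal], ClassX11b W 3 → Surj W 3 →
      (Ram W 3 → W.HasSplitMultiplicativeReductionAtPrime 3 ∧ 3 ∣ W.tamagawaProduct) → IMCDivAt₃ W) :
    HalvesTamAtThree :=
  kolyvaginRoadThree_halvesTamAtThree_iff.mpr fun W _ _ hX hsurj hloc ↦
    ⟨bdpValueAt₃_of_classicalFrameValue hC W, h3 W hX hsurj hloc⟩

include hC in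
/-- **The item reduced to its H3 stub.** Modulo THEOREM C typed, `HalvesTamAtThree` follows from the two-loci
H3 statement — verbatim the stub `stub_imcDivTamAtThree` of the BC3 skeleton ((ram) → 3 split → 3 ∣ ∏c →
`IMCDivAt₃ W`; ¬(ram) → surj → `IMCDivAt₃ W`). H3 is OPEN; nothing is discharged.
[cite: Castella2018, Thm. 3.3 (arXiv:1704.06608 p. 9) (shape of H3 only; open at p = 3)] -/
theorem kolyvaginRoadThree_halvesTamAtThree_of_classicalFrameValue_of_imcDivStub
    (h3 : ∀ (W : WeierstrassCurve ℚ) [W.IsElliptic] [W.IsGloballyMinimal], ClassX11b W 3 →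
      (Ram W 3 → W.HasSplitMultiplicativeReductionAtPrime 3 → 3 ∣ W.tamagawaProduct → IMCDivAt₃ W) ∧
        (¬ Ram W 3 → Surj W 3 → IMCDivAt₃ W)) :
    HalvesTamAtThree := by
  unfold HalvesTamAtThree
  intro W _ _ hX
  obtain ⟨hI₁, hI₂⟩ := h3 W hX
  exact ⟨fun hr hs ht ↦ ⟨bdpValueAt₃_of_classicalFrameValue hC W, hI₁ hr hs ht⟩,
    fun hnr hsu ↦ ⟨bdpValueAt₃_of_classicalFrameValue hC W, hI₂ hnr hsu⟩⟩

include hC in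
/-- Modulo THEOREM C typed, ClassRecordThree's two-loci H3 stub (`stub_imcDivAtThree` of item 19107) already
gives `HalvesTamAtThree` (through `HalvesAtThree`). [folklore] -/
theorem kolyvaginRoadThree_halvesTamAtThree_of_classicalFrameValue_of_imcDivStub'
    (h3 : ∀ (W : WeierstrassCurve ℚ) [W.IsElliptic] [W.IsGloballyMinimal], ClassX11b W 3 →
      (Ram W 3 → W.HasSplitMultiplicativeReductionAtPrime 3 → IMCDivAt₃ W) ∧
        (¬ Ram W 3 → Surj W 3 → IMCDivAt₃ W)) :
    HalvesTamAtThree :=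
  halvesTamAtThree_of_halvesAtThree
    (classRecordThree_halvesAtThree_of_classicalFrameValue_of_imcDivStub hC h3)

end TheoremC

end Summit.BirchSwinnertonDyer.BirchSwinnertonDyer.Theorems

end
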